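import Summits.ValiantsHypothesis.ValiantsHypothesis.Theorems.LacunarySymmetroidMatrixDescartesDoorA26WallBubblingTouchLift

/-!
# `DoorA26` / line `wall_bubbling` — THE φ-LIFT: mixed touch profiles + alternations ⇒ the support is in the twenty-locus

HONEST FRAMING.  Object-search cell `pub-symmetroid`, crux `Theses.LacunarySymmetroid.DoorA26` (stmt-ValiantsHypothesis-19979; OPEN, typed,
never asserted).  W2 seat val-sym-door-p1 g17, file #44; def-free helper for obligation (R) of `Cruxes/DoorA26/Lines/wall_bubbling.lean`,
continuing #43 (`…WallBubblingTouchLift`: one-type touch profiles via the trace shift).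

THE φ-LIFT (`mem_twentyLocus_of_touches_alternations_phi`).  `P(t) = Σ_l e^{δ_l t} S_l` (real symmetric `2 × 2` letters, arbitrary real exponents),
`τ₀ < ⋯ < τ₂₀` log-time abscissae with virtual signs `κ_j ≠ 0`, and SCALAR PERTURBATION COEFFICIENTS `c : Fin 6 → ℝ`, i.e. the function
`φ(t) = Σ_l c_l e^{δ_l t}` of the letters' own exponential system.  Hypotheses, sign-only (crit-2 g5's composability remark on #43):
at a non-touch abscissa `0 < κ_j · det P(τ_j)`; at a touch abscissa `det P(τ_j) = 0` and `0 < κ_j · φ(τ_j) · tr P(τ_j)` (so INSIDE touches, where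
the determinant must be pushed down, and OUTSIDE touches, where it must be pushed up, may be MIXED — the required directions are carried by the
signs of `φ` at the touch abscissae); and the `κ_j` alternate strictly.  Then `δ ∈ Bubbling.TwentyLocus`: the same-support letters
`S_l + η c_l·1` give `det(P + ηφ·1) = det P + η φ tr P + η² φ²` (`det_expPencil_scalarShift`), of the sign of `κ_j` at every abscissa for small
`η > 0` (`exists_scalarShift_signs`), and #42b's `le_ncard_of_alternations_exp` + `Census.RealExp.ncard_rpow_eq_ncard_exp` conclude.
Since `{e^{δ_l t}}` is a Chebyshev system for distinct `δ`, a `φ` with prescribed non-zero signs exists whenever the required sign pattern along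
the touch abscissae has at most `5` sign changes (in particular for ≤ 6 touches); that interpolation step is NOT done here — `c` is data.
COROLLARY (`mem_twentyLocus_of_signedTouches_alternations`): the sign-only form of #43 — one-type profiles need no `φ`: `c_l = ∓ tr S_l`.
READING for (R): after #42b (null END letters) and #43 (one-type interior touches), the φ-lift covers mixed interior touch profiles up to
the Chebyshev sign budget; what remains of the multiplicity residual is (a) mixed profiles whose required shift sign changes > 5 times along the
touches, (b) zeros of multiplicity ≥ 3.  Nothing here bears on `DoorA26`, `DoorA34`, `MatrixDescartes` (18050) or `VP ≠ VNP`; registers unchanged.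

[folklore] `det(M + c·1) = det M + c·tr M + c²` (`2 × 2`), continuity at `η = 0`; [this work] the packaging.
-/

-- `Summit.ValiantsHypothesis.ValiantsHypothesis.…` repeats a component by the D-0017 layout
-- (single-conjunct summit), which the `dupNamespace` linter flags; the name is mandated.
set_option linter.dupNamespace false

namespace Summit.ValiantsHypothesis.ValiantsHypothesis.Theorems.LacunarySymmetroidMatrixDescartes.WallBubbling

open Finset Filter Topology
open Bubbling (TwentyLocus)
open Census.RealExp (ncard_rpow_eq_ncard_exp)

/-! ## §1 The scalar shift `S_l ↦ S_l + η c_l·1` -/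

/-- Scalar-shifted letters are symmetric. [folklore] -/
theorem isSymm_add_smul_one {n : ℕ} (M : Matrix (Fin n) (Fin n) ℝ) (hM : M.IsSymm) (c : ℝ) :
    (M + c • (1 : Matrix (Fin n) (Fin n) ℝ)).IsSymm := by
  unfold Matrix.IsSymm at hM ⊢
  rw [Matrix.transpose_add, Matrix.transpose_smul, Matrix.transpose_one, hM]

/-- Evaluating the exponential pencil of the scalar-shifted letters: `Σ_l e^{δ_l t}(S_l + η c_l·1) = P(t) + (η φ(t))·1`,
`φ(t) = Σ_l c_l e^{δ_l t}`. [folklore] -/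
theorem expPencil_scalarShift (δ : Fin 6 → ℝ) (S : Fin 6 → Matrix (Fin 2) (Fin 2) ℝ) (c : Fin 6 → ℝ) (η t : ℝ) :
    (∑ l, Real.exp (δ l * t) • (S l + (η * c l) • (1 : Matrix (Fin 2) (Fin 2) ℝ)))
      = (∑ l, Real.exp (δ l * t) • S l) + (η * ∑ l, c l * Real.exp (δ l * t)) • (1 : Matrix (Fin 2) (Fin 2) ℝ) := by
  simp only [smul_add, Finset.sum_add_distrib, smul_smul, Finset.mul_sum, Finset.sum_smul]
  congr 1
  refine Finset.sum_congr rfl fun l _ => ?_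
  ring_nf

/-- Determinant of the scalar-shifted exponential pencil: `det P + (ηφ)·tr P + (ηφ)²`. [folklore] -/
theorem det_expPencil_scalarShift (δ : Fin 6 → ℝ) (S : Fin 6 → Matrix (Fin 2) (Fin 2) ℝ) (c : Fin 6 → ℝ) (η t : ℝ) :
    (∑ l, Real.exp (δ l * t) • (S l + (η * c l) • (1 : Matrix (Fin 2) (Fin 2) ℝ))).det
      = (∑ l, Real.exp (δ l * t) • S l).det + (η * ∑ l, c l * Real.exp (δ l * t)) * (∑ l, Real.exp (δ l * t) • S l).trace
        + (η * ∑ l, c l * Real.exp (δ l * t)) ^ 2 := by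
  rw [expPencil_scalarShift]
  have h := det_sub_smul_one_fin_two (∑ l, Real.exp (δ l * t) • S l) (-(η * ∑ l, c l * Real.exp (δ l * t)))
  rw [neg_smul, sub_neg_eq_add] at h
  rw [h]; ring

/-! ## §2 Choosing `η`: finitely many sign conditions -/

/-- **Sign bookkeeping of the scalar shift.**  Abscissae with virtual signs `κ_j`: `0 < κ_j D_j`, or `D_j = 0` and `0 < κ_j φ_j T_j`.  Then for some
`η > 0` every shifted value `D_j + ηφ_j T_j + η²φ_j²` has the sign of `κ_j`. [folklore] -/
theorem exists_scalarShift_signs {N : ℕ} (D T φ κ : Fin N → ℝ)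
    (hκ : ∀ j, 0 < κ j * D j ∨ (D j = 0 ∧ 0 < κ j * φ j * T j)) :
    ∃ η : ℝ, 0 < η ∧ ∀ j, 0 < κ j * (D j + η * φ j * T j + (η * φ j) ^ 2) := by
  have hev : ∀ j, ∀ᶠ η in 𝓝[>] (0 : ℝ), 0 < κ j * (D j + η * φ j * T j + (η * φ j) ^ 2) := by
    intro j
    rcases hκ j with hD | ⟨hD, hk⟩
    · -- non-touch: continuity at `η = 0`
      have hcont : Continuous fun η : ℝ => κ j * (D j + η * φ j * T j + (η * φ j) ^ 2) := by fun_prop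
      have h0 : (0 : ℝ) < κ j * (D j + 0 * φ j * T j + (0 * φ j) ^ 2) := by simpa using hD
      exact ((hcont.tendsto 0).eventually_const_lt h0).filter_mono nhdsWithin_le_nhds
    · -- touch: `κ (η φ T + η² φ²) = η (κ φ T + η κ φ²)`, and `κ φ T > 0` dominates for small `η`
      have hcont : Continuous fun η : ℝ => κ j * φ j * T j + η * (κ j * φ j ^ 2) := by fun_prop
      have h0 : (0 : ℝ) < κ j * φ j * T j + 0 * (κ j * φ j ^ 2) := by simpa using hk
      have h1 : ∀ᶠ η in 𝓝[>] (0 : ℝ), 0 < κ j * φ j * T j + η * (κ j * φ j ^ 2) :=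
        ((hcont.tendsto 0).eventually_const_lt h0).filter_mono nhdsWithin_le_nhds
      have h2 : ∀ᶠ η in 𝓝[>] (0 : ℝ), 0 < η := eventually_mem_nhdsWithin
      filter_upwards [h1, h2] with η hη hη0
      rw [hD]
      have : κ j * (0 + η * φ j * T j + (η * φ j) ^ 2) = η * (κ j * φ j * T j + η * (κ j * φ j ^ 2)) := by ring
      rw [this]
      exact mul_pos hη0 hη
  have hall : ∀ᶠ η in 𝓝[>] (0 : ℝ), 0 < η ∧ ∀ j, 0 < κ j * (D j + η * φ j * T j + (η * φ j) ^ 2) :=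
    (eventually_mem_nhdsWithin).and (Filter.eventually_all.2 hev)
  obtain ⟨η, hη0, hη⟩ := hall.exists
  exact ⟨η, hη0, hη⟩

/-! ## §3 The φ-lift -/

/-- **THE φ-LIFT (mixed touch profiles).**  Real exponents `δ`, symmetric letters, `21` strictly increasing log-time abscissae `τ` with non-zero
virtual signs `κ` and scalar perturbation coefficients `c` (`φ(t) = Σ c_l e^{δ_l t}`): `0 < κ_j det P(τ_j)` at non-touch abscissae, `det P(τ_j) = 0`
and `0 < κ_j φ(τ_j) tr P(τ_j)` at touch abscissae, `κ` strictly alternating ⇒ `δ ∈ TwentyLocus` (witness letters `S_l + η c_l·1`). [this work] -/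
theorem mem_twentyLocus_of_touches_alternations_phi (δ : Fin 6 → ℝ) (S : Fin 6 → Matrix (Fin 2) (Fin 2) ℝ)
    (hS : ∀ l, (S l).IsSymm) (τ : Fin 21 → ℝ) (hτ : StrictMono τ) (κ : Fin 21 → ℝ) (c : Fin 6 → ℝ)
    (hκ : ∀ j, 0 < κ j * (∑ l, Real.exp (δ l * τ j) • S l).det ∨
      ((∑ l, Real.exp (δ l * τ j) • S l).det = 0 ∧
        0 < κ j * (∑ l, c l * Real.exp (δ l * τ j)) * (∑ l, Real.exp (δ l * τ j) • S l).trace))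
    (halt : ∀ j : Fin 20, κ j.castSucc * κ j.succ < 0) :
    δ ∈ TwentyLocus := by
  obtain ⟨η, -, hη⟩ := exists_scalarShift_signs
    (fun j => (∑ l, Real.exp (δ l * τ j) • S l).det) (fun j => (∑ l, Real.exp (δ l * τ j) • S l).trace)
    (fun j => ∑ l, c l * Real.exp (δ l * τ j)) κ hκ
  set S' : Fin 6 → Matrix (Fin 2) (Fin 2) ℝ := fun l => S l + (η * c l) • (1 : Matrix (Fin 2) (Fin 2) ℝ) with hS'
  have hval : ∀ j, (∑ l, Real.exp (δ l * τ j) • S' l).det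
      = (∑ l, Real.exp (δ l * τ j) • S l).det
        + η * (∑ l, c l * Real.exp (δ l * τ j)) * (∑ l, Real.exp (δ l * τ j) • S l).trace
        + (η * ∑ l, c l * Real.exp (δ l * τ j)) ^ 2 := by
    intro j; rw [hS', det_expPencil_scalarShift]
  have halt' : ∀ j : Fin 20,
      (∑ l, Real.exp (δ l * τ j.castSucc) • S' l).det * (∑ l, Real.exp (δ l * τ j.succ) • S' l).det < 0 := by
    intro j
    rw [hval, hval]
    exact NullEnd.neg_of_sign_transfer (hη j.castSucc) (hη j.succ) (halt j)
  refine ⟨S', fun l => isSymm_add_smul_one (S l) (hS l) _, ?_⟩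
  rw [ncard_rpow_eq_ncard_exp]
  exact (le_ncard_of_alternations_exp δ S' (by norm_num) τ hτ halt').2

/-- **SIGN-ONLY ONE-TYPE TOUCH LIFT** (corollary; the composable form of #43): `0 < κ_j det P(τ_j)` at non-touch abscissae; at touch abscissae
`det P(τ_j) = 0 ≠ tr P(τ_j)` and `κ_j` of one fixed sign `−ε` for ALL touches (`ε = 1`: inside touches, `ε = −1`: outside touches); `κ` alternating
⇒ `δ ∈ TwentyLocus`.  Proof: the φ-lift with `c_l = −ε·tr S_l`, i.e. `φ = −ε·tr P`, so `κ_j φ tr P = −ε κ_j tr²P > 0`. [this work] -/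
theorem mem_twentyLocus_of_signedTouches_alternations (δ : Fin 6 → ℝ) (S : Fin 6 → Matrix (Fin 2) (Fin 2) ℝ)
    (hS : ∀ l, (S l).IsSymm) (τ : Fin 21 → ℝ) (hτ : StrictMono τ) (κ : Fin 21 → ℝ) (ε : ℝ) (hε : ε = 1 ∨ ε = -1)
    (hκ : ∀ j, 0 < κ j * (∑ l, Real.exp (δ l * τ j) • S l).det ∨
      ((∑ l, Real.exp (δ l * τ j) • S l).det = 0 ∧ (∑ l, Real.exp (δ l * τ j) • S l).trace ≠ 0 ∧ 0 < -ε * κ j))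
    (halt : ∀ j : Fin 20, κ j.castSucc * κ j.succ < 0) :
    δ ∈ TwentyLocus := by
  refine mem_twentyLocus_of_touches_alternations_phi δ S hS τ hτ κ (fun l => -ε * (S l).trace) ?_ halt
  intro j
  rcases hκ j with h | ⟨hD, hT, hk⟩
  · exact Or.inl h
  · refine Or.inr ⟨hD, ?_⟩
    have htr : (∑ l, -ε * (S l).trace * Real.exp (δ l * τ j)) = -ε * (∑ l, Real.exp (δ l * τ j) • S l).trace := by
      rw [Matrix.trace_sum, Finset.mul_sum]
      refine Finset.sum_congr rfl fun l _ => ?_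
      rw [Matrix.trace_smul, smul_eq_mul]; ring
    rw [htr]
    have hε2 : ε ^ 2 = 1 := by rcases hε with h | h <;> simp [h]
    have hT2 : 0 < (∑ l, Real.exp (δ l * τ j) • S l).trace ^ 2 := by positivity
    have : κ j * (-ε * (∑ l, Real.exp (δ l * τ j) • S l).trace) * (∑ l, Real.exp (δ l * τ j) • S l).trace
        = (-ε * κ j) * (∑ l, Real.exp (δ l * τ j) • S l).trace ^ 2 := by ring
    rw [this]
    exact mul_pos hk hT2

end Summit.ValiantsHypothesis.ValiantsHypothesis.Theorems.LacunarySymmetroidMatrixDescartes.WallBubbling
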